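import Literature.NumberTheory.ComplexMultiplication.CMOrderOverorderPicardClasses
import HarnessLib

/-!
# The count formula `#ICM(𝔯) = Σ_S #W̄k(S) · #Pic(S)` in any degree, `= Σ_S #Pic(S)` iff `𝔯` is Bass — and the
# number of CM tori with multiplication by an arbitrary order

Layer A3 of the Hodge/CM programme (docs/m5/MAPPING.md §1), closing the "arbitrary order" series: for the order
`𝔯 = endOrder (M_μ)` of any lattice `⊕ ℤμⱼ ⊂ K` (every order is of this form), the `K`-isomorphism classes of the CM
tori `(ℂ^Φ/D(𝔪), ι)` of type `(K, Φ)` with `ι(𝔯) ⊆ End` are counted by `#ICM(𝔯)`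
(`CMTorusIsomorphismClassesOrderFinite`), and

  `#ICM(𝔯) = Σ_{S ⊇ 𝔯 over-order} #W̄k(S) · #ClassGroup S`

(Marseglia's partition «`ICM(R) = ⊔ ICM_S`» + THEOREM 4.6 «`W̄k(S) = ICM_S/Pic(S)`» + `Pic(S) = ClassGroup S`,
`CMOrderOverorderPicardClasses`), with `Σ_S #ClassGroup S = #ICM(𝔯)` IF AND ONLY IF `𝔯` is Bass (every over-order
Gorenstein) — the quadratic case `#` classes `= Σ_{𝒪 ⊆ 𝒪′} h(𝒪′)` of `CMOrderIdealClassMonoidOverorderCount` being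
the instance «quadratic ⟹ Bass».

* §1 subring-indexed strata: `natCard_quot_stratum_eq_natCard_quot_weak_mul_natCard_classGroup_of_overorder`
  (`#ICM_S = #W̄k(S)·#ClassGroup S`), `natCard_quot_pic_stratum_eq_natCard_classGroup_of_overorder`,
  `natCard_quot_stratum_weak_eq_one_iff_of_overorder` (`#W̄k(S) = 1` iff `S` Gorenstein), `natCard_quot_stratum_weak_pos_of_overorder`;
* §2 **`natCard_quot_fractionalIdeal_eq_sum_natCard_quot_weak_mul_natCard_classGroup`** (the formula),
  **`sum_natCard_classGroup_eq_natCard_quot_fractionalIdeal_iff`** (`Σ_S #ClassGroup S = #ICM(𝔯)` iff Bass),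
  `natCard_quot_fractionalIdeal_eq_sum_natCard_classGroup_of_forall_overorder_div_div_eq`;
* §3 TORUS LEVEL: **`natCard_quot_exists_bijective_comm_eq_sum_natCard_quot_weak_mul_natCard_classGroup`** — the CM
  tori of type `(K, Φ)` with multiplication by `𝔯` fall into `Σ_S #W̄k(S)·#ClassGroup S` `K`-isomorphism classes,
  `= Σ_S #ClassGroup S` iff `𝔯` is Bass (`sum_natCard_classGroup_eq_natCard_quot_exists_bijective_comm_iff`), and the
  stratum of an over-order `S` (tori with endomorphism order EXACTLY `S`) has `#W̄k(S)·#ClassGroup S` classes.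

Conventions as in `CMOrderWeakClassesCount` (`ICM(𝔯)` = nonzero fractional `𝔯`-ideals modulo `M = x·N`; stratum
`{M ≠ 0 // ↑(M/M) = S}`; weak equivalence `1 ∈ (M:N)(N:M)`; the over-orders are the subrings `𝔯 ≤ S` module-finite
over `ℤ`, `EndOrder.finite_setOf_overorder`; «Bass» is `∀ M = MM ≠ 0, ∀ I ≠ 0, MI = I → (M:(M:I)) = I`).
Theorems only (no new definitions, no named facts).

## References
* [Marseglia2019] S. Marseglia, *Computing the ideal class monoid of an order*, J. Lond. Math. Soc. 101 (2020),
  arXiv:1805.09671 — §3 Def. 3.5, Prop. 3.7 p. 6; §4 Def. 4.2, Thm. 4.6 pp. 8–9; §5 p. 10.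
* [BuchmannLenstra1994] J. A. Buchmann, H. W. Lenstra Jr., *Approximating rings of integers in number fields*,
  JTNB 6 (1994) — §2 Prop. 2.7, p. 230.
* [Shimura1998] G. Shimura, *Abelian varieties with complex multiplication and modular functions*, PUP 1998 —
  §7.4 Props. 15–17, pp. 57–58.
-/

noncomputable section

open scoped Classical nonZeroDivisors NumberField Pointwise
open NumberField Module FractionalIdeal

namespace Literature.NumberTheory.ComplexMultiplication

open Literature.AlgebraicGeometry.Motives (CMType)
open Literature.AlgebraicGeometry.ComplexMultiplication (CMTorus.periodEquiv)
open Literature.Geometry.Kaehler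
open Literature.Geometry.Kaehler.ComplexTorus (mapMatrix)

namespace CMTypeLattice

section CountFormula

variable {K : Type} [Field K] [NumberField K]
variable {ι : Type} [Fintype ι] [DecidableEq ι] (μ : Basis ι ℚ K)
variable [IsFractionRing (endOrder (Algebra.leftMulMatrix μ)) K]

/-! ## §1 One stratum, indexed by the over-order `S` as a subring of `K` -/

/-- **THEOREM 4.6 for an over-order `S ⊇ 𝔯` given as a subring (module-finite over `ℤ`): `#ICM_S(𝔯) = #W̄k(S) ·
#ClassGroup S`.** [cite: Marseglia2019, §4 Thm. 4.6, p. 9] -/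
theorem natCard_quot_stratum_eq_natCard_quot_weak_mul_natCard_classGroup_of_overorder {S : Subring K}
    (h𝔬S : endOrder (Algebra.leftMulMatrix μ) ≤ S) (hfin : Module.Finite ℤ S) :
    Nat.card (Quot fun M N : {M : FractionalIdeal (endOrder (Algebra.leftMulMatrix μ))⁰ K //
        M ≠ 0 ∧ ((M / M : FractionalIdeal (endOrder (Algebra.leftMulMatrix μ))⁰ K) : Set K) = S} =>
      ∃ x : K, x ≠ 0 ∧ (M : FractionalIdeal (endOrder (Algebra.leftMulMatrix μ))⁰ K) =
        spanSingleton (endOrder (Algebra.leftMulMatrix μ))⁰ x * N) =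
    Nat.card (Quot fun M N : {M : FractionalIdeal (endOrder (Algebra.leftMulMatrix μ))⁰ K //
        M ≠ 0 ∧ ((M / M : FractionalIdeal (endOrder (Algebra.leftMulMatrix μ))⁰ K) : Set K) = S} =>
      (1 : K) ∈ (M : FractionalIdeal (endOrder (Algebra.leftMulMatrix μ))⁰ K) / N * (N / M)) *
    Nat.card (ClassGroup S) := by
  obtain ⟨ν, -, hν⟩ := exists_basis_coe_span_eq_and_endOrder_eq μ h𝔬S hfin
  subst hν
  exact natCard_quot_stratum_eq_natCard_quot_weak_mul_natCard_classGroup μ ν h𝔬S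

/-- **`#Pic(S)` (inside `ICM(𝔯)`) `= #ClassGroup S`** for an over-order `S` given as a subring.
[cite: Marseglia2019, §3 Def. 3.5, p. 6] -/
theorem natCard_quot_pic_stratum_eq_natCard_classGroup_of_overorder {S : Subring K}
    (h𝔬S : endOrder (Algebra.leftMulMatrix μ) ≤ S) (hfin : Module.Finite ℤ S) :
    Nat.card (Quot fun L N : {L : FractionalIdeal (endOrder (Algebra.leftMulMatrix μ))⁰ K //
        (L ≠ 0 ∧ ((L / L : FractionalIdeal (endOrder (Algebra.leftMulMatrix μ))⁰ K) : Set K) = S) ∧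
          L * (L / L / L) = L / L} =>
      ∃ x : K, x ≠ 0 ∧ (L : FractionalIdeal (endOrder (Algebra.leftMulMatrix μ))⁰ K) =
        spanSingleton (endOrder (Algebra.leftMulMatrix μ))⁰ x * N) = Nat.card (ClassGroup S) := by
  obtain ⟨ν, -, hν⟩ := exists_basis_coe_span_eq_and_endOrder_eq μ h𝔬S hfin
  subst hν
  exact natCard_quot_pic_stratum_eq_natCard_classGroup μ ν h𝔬S

/-- **`#W̄k(S) = 1` iff `S` is Gorenstein**, for an over-order `S` given as a subring («`S` Gorenstein»: the
idempotent `M = MM ≠ 0` with `↑M = S` satisfies `(M:(M:I)) = I` for all `M`-ideals `I ≠ 0`).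
[cite: Marseglia2019, §4 remark after Def. 4.2, p. 8] [cite: BuchmannLenstra1994, §2 Prop. 2.7, p. 230] -/
theorem natCard_quot_stratum_weak_eq_one_iff_of_overorder {S : Subring K}
    (h𝔬S : endOrder (Algebra.leftMulMatrix μ) ≤ S) (hfin : Module.Finite ℤ S) :
    Nat.card (Quot fun M N : {M : FractionalIdeal (endOrder (Algebra.leftMulMatrix μ))⁰ K //
        M ≠ 0 ∧ ((M / M : FractionalIdeal (endOrder (Algebra.leftMulMatrix μ))⁰ K) : Set K) = S} =>
      (1 : K) ∈ (M : FractionalIdeal (endOrder (Algebra.leftMulMatrix μ))⁰ K) / N * (N / M)) = 1 ↔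
    ∀ M : FractionalIdeal (endOrder (Algebra.leftMulMatrix μ))⁰ K, M ≠ 0 → M * M = M → (M : Set K) = S →
      ∀ I : FractionalIdeal (endOrder (Algebra.leftMulMatrix μ))⁰ K, I ≠ 0 → M * I = I → M / (M / I) = I := by
  haveI : Nonempty ι := μ.index_nonempty
  obtain ⟨P, hP0, hPP, hPS⟩ := EndOrder.exists_fractionalIdeal_coe_eq_subring h𝔬S hfin
  rw [natCard_quot_stratum_weak_eq_one_iff_forall_div_div_eq μ hPP hP0 hPS]
  refine ⟨fun h M _ _ hMS => ?_, fun h => h P hP0 hPP hPS⟩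
  rwa [show M = P from SetLike.coe_injective (hMS.trans hPS.symm)]

/-- **`1 ≤ #W̄k(S)`** (the class of `S` itself). [cite: Marseglia2019, §5 («at least two distinct classes in `W̄k(S)`,
namely `[S]` and `[Sᵗ]`» when `S` is not Gorenstein; `[S]` always), p. 10] -/
theorem natCard_quot_stratum_weak_pos_of_overorder {S : Subring K}
    (h𝔬S : endOrder (Algebra.leftMulMatrix μ) ≤ S) (hfin : Module.Finite ℤ S) :
    0 < Nat.card (Quot fun M N : {M : FractionalIdeal (endOrder (Algebra.leftMulMatrix μ))⁰ K //
        M ≠ 0 ∧ ((M / M : FractionalIdeal (endOrder (Algebra.leftMulMatrix μ))⁰ K) : Set K) = S} =>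
      (1 : K) ∈ (M : FractionalIdeal (endOrder (Algebra.leftMulMatrix μ))⁰ K) / N * (N / M)) := by
  haveI : Nonempty ι := μ.index_nonempty
  haveI := EndOrder.finite_quot_stratum_weak (ρ := Algebra.leftMulMatrix μ) (K := K) S
  obtain ⟨P, hP0, hPP, hPS⟩ := EndOrder.exists_fractionalIdeal_coe_eq_subring h𝔬S hfin
  haveI : Nonempty (Quot fun M N : {M : FractionalIdeal (endOrder (Algebra.leftMulMatrix μ))⁰ K //
        M ≠ 0 ∧ ((M / M : FractionalIdeal (endOrder (Algebra.leftMulMatrix μ))⁰ K) : Set K) = S} =>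
      (1 : K) ∈ (M : FractionalIdeal (endOrder (Algebra.leftMulMatrix μ))⁰ K) / N * (N / M)) :=
    ⟨Quot.mk _ ⟨P, hP0, by rw [EndOrder.div_self_eq_of_mul_self_eq_endOrder hP0 hPP, hPS]⟩⟩
  exact Nat.card_pos

/-! ## §2 The count formula `#ICM(𝔯) = Σ_S #W̄k(S) · #ClassGroup S` over the over-orders, any degree -/

/-- **`#ICM(𝔯) = Σ_S #W̄k(S) · #ClassGroup S`**, the sum over the (finitely many) over-orders `S ⊇ 𝔯 = endOrder (M_μ)`
— Marseglia's partition «`ICM(R) = ⊔ ICM_S`» with THEOREM 4.6 «`W̄k(S) = ICM_S/Pic(S)`» and `Pic(S) = ClassGroup S`,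
for an order of ANY degree (the quadratic case, where every `#W̄k(S) = 1`, is
`CMOrderIdealClassMonoidOverorderCount.natCard_quot_fractionalIdeal_eq_sum_natCard_classGroup`).
[cite: Marseglia2019, §4 («`ICM(R) = ⊔ ICM_S`») and Thm. 4.6, p. 9] -/
theorem natCard_quot_fractionalIdeal_eq_sum_natCard_quot_weak_mul_natCard_classGroup :
    Nat.card (Quot fun M N : {M : FractionalIdeal (endOrder (Algebra.leftMulMatrix μ))⁰ K // M ≠ 0} =>
      ∃ x : K, x ≠ 0 ∧ (M : FractionalIdeal (endOrder (Algebra.leftMulMatrix μ))⁰ K) =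
        spanSingleton (endOrder (Algebra.leftMulMatrix μ))⁰ x * N) =
      ∑ S ∈ (EndOrder.finite_setOf_overorder (ρ := Algebra.leftMulMatrix μ) (K := K)).toFinset,
        Nat.card (Quot fun M N : {M : FractionalIdeal (endOrder (Algebra.leftMulMatrix μ))⁰ K //
            M ≠ 0 ∧ ((M / M : FractionalIdeal (endOrder (Algebra.leftMulMatrix μ))⁰ K) : Set K) = S} =>
          (1 : K) ∈ (M : FractionalIdeal (endOrder (Algebra.leftMulMatrix μ))⁰ K) / N * (N / M)) *
        Nat.card (ClassGroup S) := by
  classical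
  haveI : Nonempty ι := μ.index_nonempty
  rw [EndOrder.natCard_quot_fractionalIdeal_eq_sum_natCard_quot_weak_mul_natCard_quot_pic]
  refine Finset.sum_congr rfl fun S hS => ?_
  rw [Set.Finite.mem_toFinset] at hS
  rw [natCard_quot_pic_stratum_eq_natCard_classGroup_of_overorder μ hS.1 hS.2]

/-- **`Σ_S #ClassGroup S = #ICM(𝔯)` IF AND ONLY IF `𝔯` is BASS** (every over-order `M = MM ≠ 0` is Gorenstein,
`(M:(M:I)) = I`): the defect of the inequality `Σ_S #Pic(S) ≤ #ICM(𝔯)`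
(`CMOrderIdealClassMonoidConductorDivisorSum.sum_natCard_classGroup_le_natCard_quot_fractionalIdeal`) is
`Σ_S (#W̄k(S) − 1)·#Pic(S)`, and `#W̄k(S) = 1` iff `S` is Gorenstein. [cite: Marseglia2019, §3 Prop. 3.7
(«`R` Bass ⟺ ICM(R) = ⊔ Pic(S)`») and §4 Thm. 4.6, pp. 6, 9] -/
theorem sum_natCard_classGroup_eq_natCard_quot_fractionalIdeal_iff :
    ∑ S ∈ (EndOrder.finite_setOf_overorder (ρ := Algebra.leftMulMatrix μ) (K := K)).toFinset,
        Nat.card (ClassGroup S) =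
      Nat.card (Quot fun M N : {M : FractionalIdeal (endOrder (Algebra.leftMulMatrix μ))⁰ K // M ≠ 0} =>
        ∃ x : K, x ≠ 0 ∧ (M : FractionalIdeal (endOrder (Algebra.leftMulMatrix μ))⁰ K) =
          spanSingleton (endOrder (Algebra.leftMulMatrix μ))⁰ x * N) ↔
    ∀ M : FractionalIdeal (endOrder (Algebra.leftMulMatrix μ))⁰ K, M ≠ 0 → M * M = M →
      ∀ I : FractionalIdeal (endOrder (Algebra.leftMulMatrix μ))⁰ K, I ≠ 0 → M * I = I → M / (M / I) = I := by
  classical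
  haveI : Nonempty ι := μ.index_nonempty
  rw [natCard_quot_fractionalIdeal_eq_sum_natCard_quot_weak_mul_natCard_classGroup μ,
    Finset.sum_eq_sum_iff_of_le fun S hS => ?_]
  swap
  · rw [Set.Finite.mem_toFinset] at hS
    exact Nat.le_mul_of_pos_left _ (natCard_quot_stratum_weak_pos_of_overorder μ hS.1 hS.2)
  constructor
  · intro h M hM0 hMM
    obtain ⟨S, h𝔬S, hfin, hSM⟩ := (EndOrder.mul_self_eq_iff_exists_overorder hM0).1 hMM
    have hS : S ∈ (EndOrder.finite_setOf_overorder (ρ := Algebra.leftMulMatrix μ) (K := K)).toFinset := by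
      rw [Set.Finite.mem_toFinset]
      exact ⟨h𝔬S, hfin⟩
    have h1 := h S hS
    rw [eq_comm, mul_eq_right₀ (natCard_classGroup_pos_of_overorder μ h𝔬S hfin).ne',
      natCard_quot_stratum_weak_eq_one_iff_of_overorder μ h𝔬S hfin] at h1
    exact h1 M hM0 hMM hSM.symm
  · intro h S hS
    rw [Set.Finite.mem_toFinset] at hS
    rw [eq_comm, mul_eq_right₀ (natCard_classGroup_pos_of_overorder μ hS.1 hS.2).ne',
      natCard_quot_stratum_weak_eq_one_iff_of_overorder μ hS.1 hS.2]
    exact fun M hM0 hMM _ => h M hM0 hMM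

/-- **For a BASS order, `#ICM(𝔯) = Σ_S #ClassGroup S`** in any degree (e.g. every quadratic order —
`CMOrderQuadraticBass`; orders with cyclic `𝓞_K/𝔯`). [cite: Marseglia2019, §3 Prop. 3.7, p. 6] -/
theorem natCard_quot_fractionalIdeal_eq_sum_natCard_classGroup_of_forall_overorder_div_div_eq
    (h : ∀ M : FractionalIdeal (endOrder (Algebra.leftMulMatrix μ))⁰ K, M ≠ 0 → M * M = M →
      ∀ I : FractionalIdeal (endOrder (Algebra.leftMulMatrix μ))⁰ K, I ≠ 0 → M * I = I → M / (M / I) = I) :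
    Nat.card (Quot fun M N : {M : FractionalIdeal (endOrder (Algebra.leftMulMatrix μ))⁰ K // M ≠ 0} =>
      ∃ x : K, x ≠ 0 ∧ (M : FractionalIdeal (endOrder (Algebra.leftMulMatrix μ))⁰ K) =
        spanSingleton (endOrder (Algebra.leftMulMatrix μ))⁰ x * N) =
      ∑ S ∈ (EndOrder.finite_setOf_overorder (ρ := Algebra.leftMulMatrix μ) (K := K)).toFinset,
        Nat.card (ClassGroup S) :=
  ((sum_natCard_classGroup_eq_natCard_quot_fractionalIdeal_iff μ).2 h).symm

/-! ## §3 TORUS LEVEL: the CM tori with multiplication by `𝔯`, counted over the over-orders -/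

/-- **The `K`-isomorphism classes of the CM tori `(ℂ^Φ/D(𝔪), ι)` of type `(K, Φ)` with `ι(𝔯) ⊆ End`
(`𝔯 = endOrder (M_μ)` any order, any degree) number `Σ_S #W̄k(S) · #ClassGroup S`**, the sum over the over-orders
`S ⊇ 𝔯` — each term counting the tori whose endomorphism order is EXACTLY `S`
(`CMOrderOverorderPicardClasses.natCard_quot_exists_bijective_comm_eq_natCard_quot_weak_mul_natCard_classGroup`).
[cite: Shimura1998, §7.4 Props. 15–17, p. 58] [cite: Marseglia2019, §4 Thm. 4.6, p. 9] -/
theorem natCard_quot_exists_bijective_comm_eq_sum_natCard_quot_weak_mul_natCard_classGroup (Φ : CMType K) :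
    Nat.card (Quot fun μ' μ'' : {μ' : Basis ι ℚ K //
        endOrder (Algebra.leftMulMatrix μ) ≤ endOrder (Algebra.leftMulMatrix μ')} =>
      ∃ A : Matrix ι ι ℤ,
        Function.Bijective
            (mapMatrix (CMTorus.periodEquiv Φ (μ' : Basis ι ℚ K)) (CMTorus.periodEquiv Φ (μ'' : Basis ι ℚ K)) A) ∧
          ∀ α : K, A.map (Int.cast : ℤ → ℚ) * Algebra.leftMulMatrix (μ' : Basis ι ℚ K) α =
            Algebra.leftMulMatrix (μ'' : Basis ι ℚ K) α * A.map (Int.cast : ℤ → ℚ)) =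
      ∑ S ∈ (EndOrder.finite_setOf_overorder (ρ := Algebra.leftMulMatrix μ) (K := K)).toFinset,
        Nat.card (Quot fun M N : {M : FractionalIdeal (endOrder (Algebra.leftMulMatrix μ))⁰ K //
            M ≠ 0 ∧ ((M / M : FractionalIdeal (endOrder (Algebra.leftMulMatrix μ))⁰ K) : Set K) = S} =>
          (1 : K) ∈ (M : FractionalIdeal (endOrder (Algebra.leftMulMatrix μ))⁰ K) / N * (N / M)) *
        Nat.card (ClassGroup S) := by
  haveI : Nonempty ι := μ.index_nonempty
  rw [natCard_quot_exists_bijective_comm_eq μ Φ, natCard_quot_fractionalIdeal_eq_sum_natCard_quot_weak_mul_natCard_classGroup μ]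

/-- **… and they number `Σ_S #ClassGroup S` IF AND ONLY IF `𝔯` is Bass** (e.g. `[K:ℚ] = 2`: elliptic curves,
`#` classes `= Σ_{𝔬 ⊆ 𝒪′} h(𝒪′)`). [cite: Marseglia2019, §3 Prop. 3.7 and §4 Thm. 4.6, pp. 6, 9]
[cite: Shimura1998, §7.4 Prop. 17, p. 58] -/
theorem sum_natCard_classGroup_eq_natCard_quot_exists_bijective_comm_iff (Φ : CMType K) :
    ∑ S ∈ (EndOrder.finite_setOf_overorder (ρ := Algebra.leftMulMatrix μ) (K := K)).toFinset,
        Nat.card (ClassGroup S) =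
      Nat.card (Quot fun μ' μ'' : {μ' : Basis ι ℚ K //
          endOrder (Algebra.leftMulMatrix μ) ≤ endOrder (Algebra.leftMulMatrix μ')} =>
        ∃ A : Matrix ι ι ℤ,
          Function.Bijective
              (mapMatrix (CMTorus.periodEquiv Φ (μ' : Basis ι ℚ K)) (CMTorus.periodEquiv Φ (μ'' : Basis ι ℚ K)) A) ∧
            ∀ α : K, A.map (Int.cast : ℤ → ℚ) * Algebra.leftMulMatrix (μ' : Basis ι ℚ K) α =
              Algebra.leftMulMatrix (μ'' : Basis ι ℚ K) α * A.map (Int.cast : ℤ → ℚ)) ↔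
    ∀ M : FractionalIdeal (endOrder (Algebra.leftMulMatrix μ))⁰ K, M ≠ 0 → M * M = M →
      ∀ I : FractionalIdeal (endOrder (Algebra.leftMulMatrix μ))⁰ K, I ≠ 0 → M * I = I → M / (M / I) = I := by
  haveI : Nonempty ι := μ.index_nonempty
  rw [natCard_quot_exists_bijective_comm_eq μ Φ]
  exact sum_natCard_classGroup_eq_natCard_quot_fractionalIdeal_iff μ

/-- **One stratum at torus level, subring form**: for an over-order `S ⊇ 𝔯` (module-finite over `ℤ`) the CM tori of
type `(K, Φ)` with `ι(𝔯) ⊆ End` and endomorphism order EXACTLY `S` fall into `#W̄k(S) · #ClassGroup S`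
`K`-isomorphism classes. [cite: Marseglia2019, §4 Thm. 4.6, p. 9] [cite: Shimura1998, §7.4 Props. 15–17, p. 58] -/
theorem natCard_quot_exists_bijective_comm_eq_natCard_quot_weak_mul_natCard_classGroup_of_overorder (Φ : CMType K)
    {S : Subring K} (h𝔬S : endOrder (Algebra.leftMulMatrix μ) ≤ S) (hfin : Module.Finite ℤ S) :
    Nat.card (Quot fun μ' μ'' : {μ' : Basis ι ℚ K //
        endOrder (Algebra.leftMulMatrix μ) ≤ endOrder (Algebra.leftMulMatrix μ') ∧
          endOrder (Algebra.leftMulMatrix μ') = S} =>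
      ∃ A : Matrix ι ι ℤ,
        Function.Bijective
            (mapMatrix (CMTorus.periodEquiv Φ (μ' : Basis ι ℚ K)) (CMTorus.periodEquiv Φ (μ'' : Basis ι ℚ K)) A) ∧
          ∀ α : K, A.map (Int.cast : ℤ → ℚ) * Algebra.leftMulMatrix (μ' : Basis ι ℚ K) α =
            Algebra.leftMulMatrix (μ'' : Basis ι ℚ K) α * A.map (Int.cast : ℤ → ℚ)) =
    Nat.card (Quot fun M N : {M : FractionalIdeal (endOrder (Algebra.leftMulMatrix μ))⁰ K //
        M ≠ 0 ∧ ((M / M : FractionalIdeal (endOrder (Algebra.leftMulMatrix μ))⁰ K) : Set K) = S} =>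
      (1 : K) ∈ (M : FractionalIdeal (endOrder (Algebra.leftMulMatrix μ))⁰ K) / N * (N / M)) *
    Nat.card (ClassGroup S) := by
  haveI : Nonempty ι := μ.index_nonempty
  rw [natCard_quot_exists_bijective_comm_eq_natCard_quot_stratum μ Φ S,
    natCard_quot_stratum_eq_natCard_quot_weak_mul_natCard_classGroup_of_overorder μ h𝔬S hfin]

end CountFormula

end CMTypeLattice

end Literature.NumberTheory.ComplexMultiplication
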